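import Mathlib.Analysis.SpecialFunctions.Gaussian.GaussianIntegral
import Mathlib.Analysis.SpecialFunctions.Pow.Real
import Mathlib.Analysis.Complex.ExponentialBounds
import Literature.IUT.LogVolume.Theorem110Data
import HarnessLib

/-!
# [IUTchIV] Remarks 1.10.1–1.10.7 (after Theorem 1.10) and Remarks 2.2.1–2.2.4 (after Corollary 2.2):
# the checkable mechanisms, typed and proved; the commentary, located

Mochizuki, *Inter-universal Teichmüller theory IV*, RIMS manuscript (Apr. 2020; = PRIMS **57** (2021)),
Remarks 1.10.1 (p. 31), 1.10.2 (p. 32), 1.10.3 (pp. 32–33), 1.10.4 (pp. 33–34), 1.10.5 (i)–(iii)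
(pp. 34–36), 1.10.6 (i)–(iv) (pp. 36–38), 1.10.7 (i)(ii) (pp. 38–39); Remarks 2.2.1 (i)–(v) (pp. 48–50),
2.2.2 (pp. 50–51), 2.2.3 (pp. 51–52), 2.2.4 (i)–(iv) (pp. 52–54) — twenty-four census sub-items, each read
on the page. These Remarks are COMMENTARY on Theorem 1.10 / Corollary 2.2 (typed in
`Theorem110Data.lean`, `Theorem110.lean`, `Corollary22Statement.lean`); following the cell's rule for
expository Remarks, each sub-item gets a `/-! -/` section carrying its locator and a one-line summary;
where a sub-item states a CHECKABLE mechanism it is typed as a small theorem and PROVED; pure prose carries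
no declaration. Nothing here takes a side on [IUTchIII] Cor. 3.12 (the series' key carries the D-0012
status, hence the tags). What is proved:

* Rmk 1.10.5 (ii) (p. 35): "no matter how “skillfully” one chooses `l`, the resulting “ε terms”
  [`∗·δ/l + ∗·l`] are always `≥ ∗·δ^{1/2}` — an estimate that may be obtained by thinking of `l` as `≈ δ^α`
  … and comparing `δ^α` and `δ^{1−α}`": `Rmk1105.epsilon_terms_ge` (`a·δ/l + b·l ≥ 2√(ab)·δ^{1/2}` for all
  `l > 0`, AM–GM) and the optimal choice `l = (aδ/b)^{1/2}` (`Rmk1105.epsilon_terms_eq_at_sqrt`).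
* Rmk 1.10.7 (i) (p. 38): "Since `e*_mod ≤ d*_mod`, one may replace “`e*_mod`” by “`d*_mod`” in the final
  two displays of the statement of Theorem 1.10": `Rmk1107.display_dstar_of_display`,
  `Rmk1107.displayF_dstar_of_displayF` over `Thm110Numerics`.
* Rmk 2.2.1 (i) (p. 48): "`1 < log(3)`" is the tree's `Literature.NumberTheory.LFunctions.MertensBound.one_lt_log_three`.
* Rmk 2.2.2 (p. 50): "the Gaussian integral `∫_{−∞}^{∞} e^{−x²} dx = √π`" and "`∫_{S¹} dθ = 2π`":
  `Rmk222.gaussian_integral`, `Rmk222.circle_integral` (Mathlib `integral_gaussian`).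

Deliberately NOT here: Rmk 1.10.6 (ii)'s computation of the special value of the theta series at the
2-torsion point (a unit for odd `p`, a non-unit for `p = 2`) — it belongs with [EtTh] Prop. 1.4 (layer L2);
the van Frankenhuijsen limsup conjecture quoted in Rmk 2.2.1 (ii) (a conjecture of [vFr], not typed).
-/

noncomputable section

namespace Literature.IUT.LogVolume

open Real

/-! ## Remark 1.10.1 (p. 31) — noted
"the computation of the “leading term” … `(l⋇+3)/2·log(𝔡^K_{v_ℚ}) − (2l⋇+1)(l⋇+1)/(12l)·log(q_{v_ℚ})` … via
the identities (E1), (E2) is essentially identical to the computation of the leading term that occurs in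
the proof of [HASurI], Theorem A"; "the computations … were already essentially known to the author around
the year 2000; the problem then was to construct an appropriate framework". Commentary; the leading-term
identity itself is `Thm110Local.procAvg_linear'` in `Theorem110LocalBounds.lean`. -/

/-! ## Remark 1.10.2 (p. 32) — noted
"a sort of derivative in the `F_l^⋇`-direction"; the arithmetic Kodaira–Spencer morphism of [HASurII]
concerns the unipotent matrices `(1 ∗; 0 1)` of `GL₂(𝔽_l)`, the `F_l^⋇`-symmetries the toral matrices
`(∗ 0; 0 ∗)`. Commentary (analogy); no declaration. -/

/-! ## Remark 1.10.3 (pp. 32–33) — noted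
"The “terms involving `l`” … may be thought of as an inevitable consequence of the fundamental role played
… by the `l`-torsion points"; one must work over the field of rationality `K` of the `l`-torsion points.
Commentary; no declaration. -/

/-! ## Remark 1.10.4 (pp. 33–34) — noted
"inter-universal analytic torsion": (a) analytic torsion in classical Arakelov theory, (b) Gaussian poles in
scheme-theoretic Hodge–Arakelov theory, (c) the `log(𝔡^K)` terms of Step (v) as "differential poles"; the
role of the prime number theorem (Prop. 1.6). Commentary; no declaration. -/

/-! ## Remark 1.10.5 (i) (p. 34) — noted
"the inequalities obtained in Theorem 1.10 involve only essentially explicit constants and … do not require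
one to exclude some non-explicit finite set" — suited to explicit diophantine equations "such as … “Fermat's
Last Theorem”"; "beyond the scope of the present paper". Commentary; no declaration. -/

/-! ## Remark 1.10.5 (ii) (pp. 34–35) — the `δ^{1/2}` barrier for the ε terms (PROVED below) -/

namespace Rmk1105

/-- **Rmk 1.10.5 (ii) (p. 35)**: with `F_tpd = ℚ` the bound of Theorem 1.10 reads `δ + ∗·δ/l + ∗·l + ∗`, and
"no matter how “skillfully” one chooses `l`, the resulting “ε terms” are always `≥ ∗·δ^{1/2}` — an estimate
that may be obtained by thinking of `l` as `≈ δ^α` … and comparing `δ^α` and `δ^{1−α}`": for `a, b > 0`,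
`δ ≥ 0` and every `l > 0`, `a·δ/l + b·l ≥ 2·√(a·b)·√δ` (AM–GM). [claim: Mochizuki2012, status: disputed] -/
theorem epsilon_terms_ge {a b δ l : ℝ} (ha : 0 < a) (hb : 0 < b) (hδ : 0 ≤ δ) (hl : 0 < l) :
    2 * Real.sqrt (a * b) * Real.sqrt δ ≤ a * δ / l + b * l := by
  have hab : Real.sqrt (a * b) * Real.sqrt (a * b) = a * b := Real.mul_self_sqrt (by positivity)
  have hd : Real.sqrt δ * Real.sqrt δ = δ := Real.mul_self_sqrt hδ
  have hs : 0 ≤ Real.sqrt (a * b) := Real.sqrt_nonneg _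
  have hsd : 0 ≤ Real.sqrt δ := Real.sqrt_nonneg _
  -- `(√(ab)·√δ − b·l)² ≥ 0`, divided by `b·l`
  rw [div_add' _ _ _ hl.ne', le_div_iff₀ hl]
  nlinarith [sq_nonneg (Real.sqrt (a * b) * Real.sqrt δ - b * l), mul_pos hb hl]

/-- The optimum in Rmk 1.10.5 (ii): at `l = √(aδ/b)` (i.e. `l ≈ δ^{1/2}`), `a·δ/l + b·l = 2·√(ab)·√δ` — the
"`δ^α` versus `δ^{1−α}`" comparison balances exactly at `α = 1/2`. [claim: Mochizuki2012, status: disputed] -/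
theorem epsilon_terms_eq_at_sqrt {a b δ : ℝ} (ha : 0 < a) (hb : 0 < b) (hδ : 0 < δ) :
    a * δ / Real.sqrt (a * δ / b) + b * Real.sqrt (a * δ / b) = 2 * Real.sqrt (a * b) * Real.sqrt δ := by
  have hq : 0 < a * δ / b := by positivity
  have hs : 0 < Real.sqrt (a * δ / b) := Real.sqrt_pos.mpr hq
  have hss : Real.sqrt (a * δ / b) * Real.sqrt (a * δ / b) = a * δ / b := Real.mul_self_sqrt hq.le
  -- `√(aδ/b) = √(ab)·√δ / b`
  have key : Real.sqrt (a * δ / b) * b = Real.sqrt (a * b) * Real.sqrt δ := by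
    have h1 : Real.sqrt (a * b) * Real.sqrt δ = Real.sqrt (a * b * δ) := (Real.sqrt_mul (by positivity) δ).symm
    have h2 : Real.sqrt (a * δ / b) * b = Real.sqrt (a * δ / b) * Real.sqrt (b ^ 2) := by
      rw [Real.sqrt_sq hb.le]
    rw [h1, h2, ← Real.sqrt_mul hq.le]
    congr 1; field_simp
  have e1 : a * δ / Real.sqrt (a * δ / b) = b * Real.sqrt (a * δ / b) := by
    rw [div_eq_iff hs.ne']
    calc a * δ = b * (a * δ / b) := by field_simp
      _ = b * Real.sqrt (a * δ / b) * Real.sqrt (a * δ / b) := by rw [mul_assoc, hss]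
  rw [e1]
  linear_combination 2 * key

end Rmk1105

/-! ## Remark 1.10.5 (iii) (pp. 35–36) — noted
the "`∗·l`" portion of the ε terms arises from the estimate for `log(𝔰^≤)` in Step (viii); it "corresponds,
roughly speaking, to the number of [the prime factors of `abc`] that are `≤ e*_mod·l`" (cf. `ω(abc)`, [vFr]
§3, Baker's refinements). Commentary; no declaration. -/

/-! ## Remark 1.10.6 (i) (p. 36) — noted
"the bound on “`(1/6)·log(q)`” given in Theorem 1.10 only concerns the `q`-parameters at the nonarchimedean
valuations contained in `𝕍^bad_mod`, all of which are necessarily of odd residue characteristic" (cf. [Mss];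
a remark of A. Venkatesh). Recorded in `Corollary22Statement.lean` as `logQAvoid P {2, l}`; no declaration. -/

/-! ## Remark 1.10.6 (ii) (pp. 36–38) — noted
why primes over `2` are excluded from `𝕍^bad_mod`: [EtTh] fails at `p = 2` — the special value of the
theta series at the 2-torsion point of the irreducible component labeled zero "is a unit for odd `p`, but is
equal to a [nonzero] non-unit when `p = 2`", so the integral structures (a) and (b) differ at `p = 2`.
The series computation belongs with [EtTh] Prop. 1.4 (layer L2); no declaration here. -/

/-! ## Remark 1.10.6 (iii) (p. 38) — noted
"It is not entirely clear to the author … to what extent the integral structure (b) is necessary"; if it is,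
the theory "is fundamentally incompatible with the inclusion in `𝕍^bad_mod` of nonarchimedean primes of even
residue characteristic". Commentary; no declaration. -/

/-! ## Remark 1.10.6 (iv) (p. 38) — noted
the classical theory of theta functions (Mumford), and `p`-adic Teichmüller theory, also exclude / change
form at the prime `2`. Commentary; no declaration. -/

/-! ## Remark 1.10.7 (i) (p. 38) — `e*_mod ↦ d*_mod` in the displays (PROVED below) -/

namespace Rmk1107

open Thm110Numerics

/-- `e*_mod ≤ d*_mod` (p. 22: "`e*_mod := 2^{12}·3^3·5·e_mod (≤ d*_mod)`", from `e_mod ≤ d_mod`), as reals.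
[claim: Mochizuki2012, status: disputed] -/
theorem estar_le_dstar (X : Thm110Numerics) : (X.estar : ℝ) ≤ X.dstar := by
  have h : X.estar ≤ X.dstar := by
    unfold Thm110Numerics.estar Thm110Numerics.dstar
    exact Nat.mul_le_mul_left _ X.emod_le_dmod
  exact_mod_cast h

/-- The first display of Theorem 1.10 with `d*_mod` in place of `e*_mod`:
`(1/6)·log(q) ≤ (1 + 20·d_mod/l)·(log(𝔡^{F_tpd}) + log(𝔣^{F_tpd})) + 20·(d*_mod·l + η_prm)` (the form applied in
the proof of Cor. 2.2 (ii), p. 46). [claim: Mochizuki2012, status: disputed] -/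
def DisplayDstar (X : Thm110Numerics) : Prop :=
  1 / 6 * X.logq ≤ (1 + 20 * (X.dmod : ℝ) / X.l) * (X.logDiffTpd + X.logCondTpd)
    + 20 * ((X.dstar : ℝ) * X.l + X.etaPrm)

/-- **Rmk 1.10.7 (i) (p. 38)**: "Since `e*_mod ≤ d*_mod`, one may replace “`e*_mod`” by “`d*_mod`” in the final
two displays of the statement of Theorem 1.10" — first display. [claim: Mochizuki2012, status: disputed] -/
theorem display_dstar_of_display (X : Thm110Numerics) (h : X.Display) : DisplayDstar X := by
  unfold Thm110Numerics.Display at h; unfold DisplayDstar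
  have he := estar_le_dstar X
  have hl : (0 : ℝ) ≤ X.l := by positivity
  nlinarith [mul_le_mul_of_nonneg_right he hl]

/-- The second display of Theorem 1.10 with `d*_mod` in place of `e*_mod`.
[claim: Mochizuki2012, status: disputed] -/
def DisplayFDstar (X : Thm110Numerics) : Prop :=
  1 / 6 * X.logq ≤ (1 + 20 * (X.dmod : ℝ) / X.l) * (X.logDiffF + X.logCondF)
    + 20 * ((X.dstar : ℝ) * X.l + X.etaPrm)

/-- **Rmk 1.10.7 (i) (p. 38)**, second display. [claim: Mochizuki2012, status: disputed] -/
theorem displayF_dstar_of_displayF (X : Thm110Numerics) (h : X.DisplayF) : DisplayFDstar X := by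
  unfold Thm110Numerics.DisplayF at h; unfold DisplayFDstar
  have he := estar_le_dstar X
  have hl : (0 : ℝ) ≤ X.l := by positivity
  nlinarith [mul_le_mul_of_nonneg_right he hl]

end Rmk1107

/-! ## Remark 1.10.7 (ii) (pp. 38–39) — noted
"it is not possible to replace “`d_mod`” by “`e_mod`” in the final two displays": the tensor packets are
tensor products over `ℚ` of copies of `F_mod` labeled by `j ∈ F_l^⋇`, so at a prime `p` one cannot avoid
tensor products of localizations at distinct primes over `p`, and each ramified one contributes a `log(p)`
to `log(𝔰^ℚ)` ("rounding up" non-integral powers of `p`, Prop. 1.4 (iii)). Commentary on the SHAPE of the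
bound (the coefficient `(1 + 12·d_mod/l)` in `Thm110Numerics.bracket`); no declaration. -/

/-! ## Remark 2.2.1 (i) (p. 48) — asymptotic shape `(1/6)·h ≤ δ + ∗·δ^{1/2}·log(δ)` — noted -/

-- The numerical part "`1 < log(3)`" of Rmk 2.2.1 (i) is already in the tree, verbatim:
-- `Literature.NumberTheory.LFunctions.MertensBound.one_lt_log_three` (not restated here). The bounds
-- `log(3) ≤ δ, h` for an elliptic curve over `ℚ` with `F_tpd = ℚ` are statements about conductors /
-- `q`-parameters of such curves and are not typed here.

/-! ## Remark 2.2.1 (ii) (p. 49) — noted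
[vFr] §2 conjectures `limsup log((1/6)·h − δ)/log(h) = 1/2`; the bounds of Cor. 2.2 (ii) give `≤ 1/2` on a
compactly bounded subset `K_V`; whether `≥ 1/2` persists inside a single `K_V` "is not clear to the author".
A conjecture of [vFr]; not typed. -/

/-! ## Remark 2.2.1 (iii)–(v) (pp. 49–50) — noted
(iii) Mellin transform / theta functions: hope for an "inter-universal Mellin transform"; (iv) analogy with the
derivative of a Frobenius lifting and the Riemann hypothesis over finite fields; (v) "(ABC inequality)|_{canonical
number}" as a restriction to a "canonical number". Commentary; no declaration. -/

/-! ## Remark 2.2.2 (pp. 50–51) — the Gaussian integral and `∫_{S¹} dθ` (PROVED from Mathlib) -/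

namespace Rmk222

/-- **Rmk 2.2.2 (p. 50)**: "the Gaussian integral `∫_{−∞}^{∞} e^{−x²} dx = √π`" (Mathlib `integral_gaussian`).
[claim: Mochizuki2012, status: disputed] -/
theorem gaussian_integral : ∫ x : ℝ, Real.exp (-x ^ 2) = Real.sqrt Real.pi := by
  have h := integral_gaussian 1
  simp only [div_one] at h
  rw [← h]
  congr 1; funext x; ring_nf

/-- **Rmk 2.2.2 (p. 50)**: "the notion of a single Tate twist may be thought of as corresponding to the integral
`∫_{S¹} dθ = 2π` over the unit circle". [claim: Mochizuki2012, status: disputed] -/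
theorem circle_integral : ∫ _θ in (0 : ℝ)..(2 * Real.pi), (1 : ℝ) = 2 * Real.pi := by
  simp

end Rmk222

/-! ## Remark 2.2.3 (pp. 51–52) — noted
for arbitrary `d`, (C2) of Cor. 2.2 (ii) with (iii) is "a sort of “weak version” of the so-called “uniform ABC
Conjecture”" — weak because restricted to `K_V` and because the height bounds on `Exc_d`, `Exc_{ε,d}` depend
on `d` (the `d^{4+ε_d}` of `Corollary22Statement.PartII/PartIII`). Commentary; no declaration. -/

/-! ## Remark 2.2.4 (i)–(iv) (pp. 52–54) — noted
analogy with `p`-adic Teichmüller theory ([pOrd]): "canonical number ⟷ modular Frobenius liftings"; (ii) the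
`∗·l` term arises by applying the prime number theorem (Prop. 1.6) to sum log-volumes of log-shells, and `l`
is "roughly of the order of the square root of the height" ((C1)); (iii) the gap `K_V` versus `M_ell(ℚ̄)` is
bridged in Cor. 2.3 by [GenEll] Thm. 2.1 ("arithmetic analytic continuation by means of [noncritical] Belyi
maps"); (iv) see p. 54. Commentary; no declaration. -/

end Literature.IUT.LogVolume

end
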